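import Literature.Probability.Process.LocalRubberCompact
import Mathlib.MeasureTheory.Constructions.BorelSpace.Order
import Mathlib.MeasureTheory.Measure.GiryMonad
import Mathlib.Topology.MetricSpace.Thickening
import HarnessLib

/-!
# The compact metric space of rooted hard-core configurations and its counting-measure map

Topic: `Literature/Probability/Process`. Sequel of `LocalRubberCompact.lean` (definition request
`defn-LocallyMatches`, part (2)): the space on which Benjamini–Schramm (local weak) limits of
finite configurations seen from a typical particle are taken, packaged for the provers of the
`BenjaminiSchrammLimit` construction, and its MEASURABLE embedding into the configurations-as-
measures used by `IsRootedHardCore` / `IsPointStationaryLaw` (`PointStationaryLaw.lean`).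

* `LocalConfig.RootedHardCoreConfig E δ` — the subtype of `LocalConfig E` of configurations
  containing the root `0` whose points are `δ`-separated (`x ≠ y ⇒ δ ≤ dist x y`), with the local
  rubber metric. For `δ > 0` (`[Fact (0 < δ)]`): a `MetricSpace` (separated sets are closed and
  the rubber pseudometric separates closed sets, `eq_of_isClosed_of_dist_eq_zero`) and, for
  proper `E`, a `CompactSpace` (`isCompact_setOf_rooted_separated`; Baake–Lenz
  [BaakeLenz2004, §4 Prop. 4]) — a compact metric space, the setting of Prokhorov's theorem.
* `LocalConfig.RootedHardCoreConfig.ofFinite x hsep i` — a finite configuration with pairwise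
  distances `≥ δ` seen from its particle `i` (recentred point set `range (x · - x i)`), the
  atoms of the empirical rooted law.
* `LocalConfig.exists_forall_encard_inter_le`, `LocalConfig.finite_inter_of_separated` — UNIFORM
  PACKING BOUND: a `δ`-separated set has at most `C(K, δ)` points in a compact `K` (so local
  functionals `S ↦ ∑_{y ∈ S} f y` are bounded uniformly in `S`), in particular finitely many;
  `LocalConfig.eventually_encard_inter_le` — **local monotonicity of point counts**: near a
  `δ`-separated `S₀`, every `δ`-separated `S` has at most as many points in a compact `K` as `S₀`
  (points of `S ∩ K` are matched injectively to points of `S₀`, which lie in `K` once the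
  matching tolerance is below the gap between `K` and the finitely many nearby points of `S₀`
  outside `K`); hence `S ↦ #(S ∩ K)` is upper semicontinuous (`measurable_count_inter`).
* `LocalConfig.measurable_toMeasure` — **the counting-measure map `S ↦ count|S` is Borel
  measurable** from `RootedHardCoreConfig E δ` (`δ > 0`, `E` proper) to `Measure E` with the Giry
  σ-algebra: by the π-λ theorem from compact-window counts (closed sets generate the Borel
  σ-algebra; complements and disjoint unions inside bounded windows; monotone limit over windows).
  This is the measurability half of Baake–Lenz [BaakeLenz2004, §4 Thm 4] (`δ : 𝒟_V → ℳ` is even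
  a homeomorphism onto its image for the vague topology; continuity is not formalised here), and it
  is what turns a weak limit of laws on `RootedHardCoreConfig E δ` into a law
  `P : Measure (Measure E)` as in the route items.

## Usage (Benjamini–Schramm limits)
With `[Fact (0 < δ)]`, `E` proper and Borel: `RootedHardCoreConfig E δ` is a compact metric
Borel space, so Mathlib provides `CompactSpace (ProbabilityMeasure (RootedHardCoreConfig E δ))`
(`Mathlib.MeasureTheory.Measure.Prokhorov`) and the Lévy–Prokhorov metrisation of weak
convergence: every sequence of laws of random rooted hard-core configurations (e.g. a finite
ground state re-rooted at a uniform particle) has a weakly convergent subsequence, and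
`measurable_toMeasure` pushes the limit to a law `P : Measure (Measure E)`.
NOT here: continuity of `S ↦ count|S` for the vague topology (Baake–Lenz Thm 4 in full) and the
closedness of `IsPointStationaryLaw` under such limits.

## References
* M. Baake, D. Lenz, Ergodic Theory Dynam. Systems 24 (2004), §4 Def. 3, Prop. 4, Thm 4.
  [BaakeLenz2004]
-/

noncomputable section

open _root_.MeasureTheory Set Filter Metric TopologicalSpace
open scoped _root_.Topology ENNReal

namespace Literature.Probability.Process

namespace LocalConfig

/-! ### Separated sets: closedness, local finiteness, local monotonicity of counts -/

section Separated

variable {E : Type*} [NormedAddCommGroup E]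

/-- A `δ`-separated set (`δ > 0`) is closed. [folklore] -/
theorem isClosed_of_separated {S : Set E} {δ : ℝ} (hδ : 0 < δ)
    (hS : ∀ x ∈ S, ∀ y ∈ S, x ≠ y → δ ≤ dist x y) : IsClosed S :=
  Metric.isClosed_of_pairwise_le_dist hδ fun x hx y hy hxy => hS x hx y hy hxy

/-- **Uniform packing bound**: for `δ > 0` and `K` compact there is `C` such that every
`δ`-separated set has at most `C` points in `K` (they inject into a finite `δ/2`-net of `K`).
[folklore] -/
theorem exists_forall_encard_inter_le {δ : ℝ} (hδ : 0 < δ) {K : Set E} (hK : IsCompact K) :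
    ∃ C : ℕ, ∀ S : Set E, (∀ x ∈ S, ∀ y ∈ S, x ≠ y → δ ≤ dist x y) → (K ∩ S).encard ≤ C := by
  obtain ⟨t, -, ht, hcover⟩ :=
    Metric.finite_approx_of_totallyBounded hK.totallyBounded (δ / 2) (half_pos hδ)
  refine ⟨ht.toFinset.card, fun S hS => ?_⟩
  have hc : ∀ p ∈ K ∩ S, ∃ y ∈ t, dist p y < δ / 2 := fun p hp => by
    simpa only [mem_iUnion, Metric.mem_ball, exists_prop] using hcover hp.1
  choose! c hc using hc
  rw [← ht.encard_eq_coe_toFinset_card]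
  refine encard_le_encard_of_injOn (fun p hp => (hc p hp).1) fun p hp p' hp' hpp' => ?_
  by_contra hne
  have h1 := hS p hp.2 p' hp'.2 hne
  have h3 : dist (c p) p' < δ / 2 := by
    rw [hpp', dist_comm]
    exact (hc p' hp').2
  have h2 : dist p p' < δ :=
    calc dist p p' ≤ dist p (c p) + dist (c p) p' := dist_triangle _ _ _
      _ < δ / 2 + δ / 2 := add_lt_add (hc p hp).2 h3
      _ = δ := by ring
  linarith

/-- A `δ`-separated set (`δ > 0`) meets every compact set in a finite set. [folklore] -/
theorem finite_inter_of_separated {S : Set E} {δ : ℝ} (hδ : 0 < δ)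
    (hS : ∀ x ∈ S, ∀ y ∈ S, x ≠ y → δ ≤ dist x y) {K : Set E} (hK : IsCompact K) :
    (K ∩ S).Finite := by
  obtain ⟨C, hC⟩ := exists_forall_encard_inter_le hδ hK
  exact finite_of_encard_le_coe (hC S hS)

variable [ProperSpace E]

/-- **Local monotonicity of point counts in the local rubber topology.** Let `S₀` be
`δ`-separated (`δ > 0`) and `K` compact. Then for all configurations `S` close enough to `S₀`,
if `S` is `δ`-separated, `#(K ∩ S) ≤ #(K ∩ S₀)`: a fine matching sends the points of `S` in `K`
injectively (separation of `S`) to points of `S₀` within the tolerance, and these lie in `K` as soon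
as the tolerance is below the positive gap between `K` and the finitely many points of `S₀` near but
outside `K`. [folklore] -/
theorem eventually_encard_inter_le {δ : ℝ} (hδ : 0 < δ) {K : Set E} (hK : IsCompact K)
    (S₀ : LocalConfig E) (h₀ : ∀ x ∈ S₀, ∀ y ∈ S₀, x ≠ y → δ ≤ dist x y) :
    ∀ᶠ S : LocalConfig E in 𝓝 S₀, (∀ x ∈ S, ∀ y ∈ S, x ≠ y → δ ≤ dist x y) →
      (K ∩ (S : Set E)).encard ≤ (K ∩ (S₀ : Set E)).encard := by
  -- the finitely many points of `S₀` within distance `1` of `K`, and the gap `η₀`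
  have hF : (cthickening 1 K ∩ (S₀ : Set E)).Finite :=
    finite_inter_of_separated hδ h₀ hK.cthickening
  obtain ⟨η₀, hη₀, hη₀K⟩ : ∃ η₀ : ℝ, 0 < η₀ ∧ ∀ x ∈ (S₀ : Set E), x ∈ cthickening 1 K →
      infDist x K < η₀ → x ∈ K := by
    by_cases hne : ((cthickening 1 K ∩ (S₀ : Set E)) \ K).Nonempty
    · obtain ⟨x₀, hx₀, hmin⟩ :=
        Set.exists_min_image _ (fun x => infDist x K) hF.sdiff hne
      have hx₀K : x₀ ∉ K := hx₀.2
      have hpos : 0 < infDist x₀ K := by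
        have hKne : K.Nonempty := by
          by_contra hKe
          rw [not_nonempty_iff_eq_empty] at hKe
          rw [hKe, cthickening_empty] at hx₀
          exact hx₀.1.1
        rcases (infDist_nonneg (x := x₀) (s := K)).eq_or_lt with h | h
        · exact absurd ((hK.isClosed.mem_iff_infDist_zero hKne).2 h.symm) hx₀K
        · exact h
      refine ⟨infDist x₀ K, hpos, fun x hxS hxc hlt => ?_⟩
      by_contra hxK
      exact absurd (hmin x ⟨⟨hxc, hxS⟩, hxK⟩) (not_le.2 hlt)
    · refine ⟨1, one_pos, fun x hxS hxc _ => ?_⟩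
      by_contra hxK
      exact hne ⟨x, ⟨hxc, hxS⟩, hxK⟩
  obtain ⟨R, hR⟩ := hK.isBounded.subset_closedBall (0 : E)
  -- tolerance
  set η := min (η₀ / 2) (min (δ / 3) 1) with hη_def
  have hη : 0 < η := lt_min (by positivity) (lt_min (by positivity) one_pos)
  have hηη₀ : η < η₀ := by
    have := min_le_left (η₀ / 2) (min (δ / 3) 1)
    linarith
  have h2η : 2 * η < δ := by
    have := (min_le_right (η₀ / 2) (min (δ / 3) 1)).trans (min_le_left _ _)
    linarith
  have hη1 : η ≤ 1 := (min_le_right _ _).trans (min_le_right _ _)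
  have hmem : {T : LocalConfig E | LocallyMatches R η (S₀ : Set E) T} ∈ 𝓝 S₀ :=
    (nhds_hasBasis_locallyMatches S₀).mem_of_mem (i := (R, η)) hη
  filter_upwards [hmem] with S hS hsepS
  -- the matching map `q : K ∩ S → K ∩ S₀`
  have hq : ∀ p ∈ K ∩ (S : Set E), ∃ q ∈ (S₀ : Set E), dist q p ≤ η := fun p hp =>
    hS.1 p hp.2 (mem_closedBall_zero_iff.1 (hR hp.1))
  choose! q hq using hq
  refine encard_le_encard_of_injOn (f := q) (fun p hp => ⟨?_, (hq p hp).1⟩) ?_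
  · refine hη₀K (q p) (hq p hp).1 ?_ ?_
    · exact mem_cthickening_of_dist_le (q p) p 1 K hp.1 ((hq p hp).2.trans hη1)
    · exact ((infDist_le_dist_of_mem hp.1).trans (hq p hp).2).trans_lt hηη₀
  · intro p hp p' hp' hpp'
    by_contra hne
    have h1 := hsepS p hp.2 p' hp'.2 hne
    have : dist p p' ≤ 2 * η :=
      calc dist p p' ≤ dist p (q p) + dist (q p) p' := dist_triangle _ _ _
        _ ≤ η + η := add_le_add (by rw [dist_comm]; exact (hq p hp).2)
            (by rw [hpp']; exact (hq p' hp').2)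
        _ = 2 * η := by ring
    linarith

end Separated

/-! ### The space of rooted hard-core configurations -/

section Space

variable (E : Type*) [SeminormedAddCommGroup E] (δ : ℝ)

/-- **Rooted `δ`-hard-core configurations**: the configurations `S : LocalConfig E` containing
the root `0` whose points are `δ`-separated, with the (restricted) local rubber metric. These are
exactly the carriers of `IsRootedHardCore δ` (`isRootedHardCore_toMeasure_iff`); Baake–Lenz's
`𝒟_V` with a marked origin. [cite: BaakeLenz2004, §4 Def. 3] -/
abbrev RootedHardCoreConfig : Type _ :=
  {S : LocalConfig E // (0 : E) ∈ S ∧ ∀ x ∈ S, ∀ y ∈ S, x ≠ y → δ ≤ dist x y}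

end Space

section Instances

variable {E : Type*} [NormedAddCommGroup E] {δ : ℝ}

/-- The carrier of a rooted `δ`-hard-core configuration (`δ > 0`) is a closed set. [folklore] -/
theorem RootedHardCoreConfig.isClosed_coe (hδ : 0 < δ) (S : RootedHardCoreConfig E δ) :
    IsClosed ((S.1 : LocalConfig E) : Set E) :=
  isClosed_of_separated hδ S.2.2

/-- For `δ > 0` the local rubber pseudometric SEPARATES rooted hard-core configurations
(their carriers are closed, `eq_of_isClosed_of_dist_eq_zero`). [cite: BaakeLenz2004, §4 Thm 3] -/
instance RootedHardCoreConfig.instT0Space [Fact (0 < δ)] : T0Space (RootedHardCoreConfig E δ) := by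
  rw [t0Space_iff_inseparable]
  intro S T h
  rw [Metric.inseparable_iff] at h
  exact Subtype.ext (eq_of_isClosed_of_dist_eq_zero (RootedHardCoreConfig.isClosed_coe Fact.out S)
    (RootedHardCoreConfig.isClosed_coe Fact.out T) h)

/-- **Rooted hard-core configurations form a metric space** (`δ > 0`).
[cite: BaakeLenz2004, §4 Thm 3] -/
instance RootedHardCoreConfig.instMetricSpace [Fact (0 < δ)] :
    MetricSpace (RootedHardCoreConfig E δ) :=
  MetricSpace.ofT0PseudoMetricSpace _

/-- **Rooted hard-core configurations form a compact space** (`δ > 0`, `E` proper): a compact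
metric space, on which every sequence of laws has a weakly convergent subsequence (Prokhorov).
[cite: BaakeLenz2004, §4 Prop. 4] -/
instance RootedHardCoreConfig.instCompactSpace [Fact (0 < δ)] [ProperSpace E] :
    CompactSpace (RootedHardCoreConfig E δ) :=
  isCompact_iff_compactSpace.1 (isCompact_setOf_rooted_separated (E := E) Fact.out)

end Instances

/-! ### Finite configurations seen from a particle -/

section Finite

variable {E : Type*} [NormedAddCommGroup E] {δ : ℝ} {N : ℕ}

/-- **A finite configuration seen from its particle `i`**: the point set `{x k - x i | k}` of a
finite configuration `x : Fin N → E` with pairwise distances `≥ δ`, recentred at `x i`, as a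
rooted `δ`-hard-core configuration (the root is `x i - x i = 0`). Re-rooting a finite ground
state at a uniformly chosen particle gives the empirical rooted law of the Benjamini–Schramm
construction. [folklore] -/
def RootedHardCoreConfig.ofFinite (x : Fin N → E) (hsep : ∀ j k, j ≠ k → δ ≤ dist (x j) (x k))
    (i : Fin N) : RootedHardCoreConfig E δ :=
  ⟨LocalConfig.mk (Set.range fun k => x k - x i), ⟨i, sub_self _⟩, by
    rintro _ ⟨j, rfl⟩ _ ⟨k, rfl⟩ hjk
    rw [dist_sub_right]
    exact hsep j k fun h => hjk (by simp only [h])⟩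

/-- The carrier of `ofFinite x hsep i` is `Set.range (x · - x i)`. [folklore] -/
@[simp] theorem RootedHardCoreConfig.coe_ofFinite (x : Fin N → E)
    (hsep : ∀ j k, j ≠ k → δ ≤ dist (x j) (x k)) (i : Fin N) :
    (((RootedHardCoreConfig.ofFinite x hsep i).1 : LocalConfig E) : Set E) =
      Set.range fun k => x k - x i :=
  rfl

/-- The counting measure of `ofFinite x hsep i` is `count|(range (x · - x i))`, the rooted
configuration `μ` of the density-transfer clause of `BenjaminiSchrammLimit`. [folklore] -/
theorem RootedHardCoreConfig.toMeasure_ofFinite [MeasurableSpace E] (x : Fin N → E)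
    (hsep : ∀ j k, j ≠ k → δ ≤ dist (x j) (x k)) (i : Fin N) :
    ((RootedHardCoreConfig.ofFinite x hsep i).1 : LocalConfig E).toMeasure =
      (Measure.count : Measure E).restrict (Set.range fun k => x k - x i) :=
  rfl

end Finite

/-! ### Measurability of the counting-measure map -/

section Measurable

variable {E : Type*} [NormedAddCommGroup E] [ProperSpace E] [MeasurableSpace E] [BorelSpace E]
  {δ : ℝ}

/-- **Window counts are upper semicontinuous, hence Borel**: for `δ > 0` and compact `K`, the
number of points in `K`, `S ↦ count (K ∩ S)`, is a measurable function on rooted `δ`-hard-core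
configurations (`eventually_encard_inter_le`). [folklore] -/
theorem measurable_count_inter (hδ : 0 < δ) {K : Set E} (hK : IsCompact K) :
    Measurable fun S : RootedHardCoreConfig E δ =>
      (Measure.count : Measure E) (K ∩ ((S.1 : LocalConfig E) : Set E)) := by
  refine UpperSemicontinuous.measurable fun S₀ c hc => ?_
  have hev := (continuous_subtype_val.tendsto S₀).eventually
    (eventually_encard_inter_le hδ hK S₀.1 S₀.2.2)
  filter_upwards [hev] with S hS
  refine lt_of_le_of_lt ?_ hc
  have hmS : MeasurableSet (K ∩ ((S.1 : LocalConfig E) : Set E)) :=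
    hK.isClosed.measurableSet.inter (RootedHardCoreConfig.isClosed_coe hδ S).measurableSet
  have hmS₀ : MeasurableSet (K ∩ ((S₀.1 : LocalConfig E) : Set E)) :=
    hK.isClosed.measurableSet.inter (RootedHardCoreConfig.isClosed_coe hδ S₀).measurableSet
  rw [Measure.count_apply hmS, Measure.count_apply hmS₀]
  exact ENat.toENNReal_le.2 (hS S.2.2)

/-- Window counts of measurable sets are measurable: for every measurable `s ⊆ E` and window
`B̄(0, m)`, `S ↦ count (s ∩ B̄(0, m) ∩ S)` is measurable on rooted `δ`-hard-core configurations
(π-λ from closed `s`, `measurable_count_inter`). [folklore] -/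
theorem measurable_count_inter_closedBall (hδ : 0 < δ) {s : Set E} (hs : MeasurableSet s) (m : ℕ) :
    Measurable fun S : RootedHardCoreConfig E δ =>
      (Measure.count : Measure E) (s ∩ closedBall (0 : E) m ∩ ((S.1 : LocalConfig E) : Set E)) := by
  have h_eq : ‹MeasurableSpace E› = MeasurableSpace.generateFrom {t : Set E | IsClosed t} :=
    (BorelSpace.measurable_eq (α := E)).trans (borel_eq_generateFrom_isClosed (α := E))
  have h_pi : IsPiSystem {t : Set E | IsClosed t} := fun t ht u hu _ => ht.inter hu
  revert m
  refine MeasurableSpace.induction_on_inter (C := fun t _ => ∀ m : ℕ, Measurable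
    fun S : RootedHardCoreConfig E δ => (Measure.count : Measure E)
      (t ∩ closedBall (0 : E) m ∩ ((S.1 : LocalConfig E) : Set E))) h_eq h_pi ?_ ?_ ?_ ?_ s hs
  · intro m
    simp only [empty_inter, measure_empty]
    exact measurable_const
  · intro t ht m
    exact measurable_count_inter hδ ((isCompact_closedBall (0 : E) m).inter_left ht)
  · intro t htm ih m
    have hB := measurable_count_inter hδ (isCompact_closedBall (0 : E) m) (δ := δ)
    have hident : ∀ S : RootedHardCoreConfig E δ, (Measure.count : Measure E)
        (tᶜ ∩ closedBall (0 : E) m ∩ ((S.1 : LocalConfig E) : Set E)) =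
        (Measure.count : Measure E) (closedBall (0 : E) m ∩ ((S.1 : LocalConfig E) : Set E)) -
        (Measure.count : Measure E)
          (t ∩ closedBall (0 : E) m ∩ ((S.1 : LocalConfig E) : Set E)) := by
      intro S
      have hSm : MeasurableSet ((S.1 : LocalConfig E) : Set E) :=
        (RootedHardCoreConfig.isClosed_coe hδ S).measurableSet
      have hfin : (closedBall (0 : E) m ∩ ((S.1 : LocalConfig E) : Set E)).Finite :=
        finite_inter_of_separated hδ S.2.2 (isCompact_closedBall _ _)
      have hset : tᶜ ∩ closedBall (0 : E) m ∩ ((S.1 : LocalConfig E) : Set E) =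
          (closedBall (0 : E) m ∩ ((S.1 : LocalConfig E) : Set E)) \
            (t ∩ closedBall (0 : E) m ∩ ((S.1 : LocalConfig E) : Set E)) := by
        ext x
        simp only [mem_inter_iff, mem_compl_iff, Set.mem_sdiff]
        tauto
      have hsub : t ∩ closedBall (0 : E) m ∩ ((S.1 : LocalConfig E) : Set E) ⊆
          closedBall (0 : E) m ∩ ((S.1 : LocalConfig E) : Set E) := fun x hx => ⟨hx.1.2, hx.2⟩
      rw [hset, measure_sdiff hsub
        ((htm.inter measurableSet_closedBall).inter hSm).nullMeasurableSet
        ((measure_mono hsub).trans_lt (Measure.count_apply_lt_top.2 hfin)).ne]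
    simp_rw [hident]
    exact hB.sub (ih m)
  · intro f hdisj hfm ih m
    have hident : ∀ S : RootedHardCoreConfig E δ, (Measure.count : Measure E)
        ((⋃ i, f i) ∩ closedBall (0 : E) m ∩ ((S.1 : LocalConfig E) : Set E)) =
        ∑' i, (Measure.count : Measure E)
          (f i ∩ closedBall (0 : E) m ∩ ((S.1 : LocalConfig E) : Set E)) := by
      intro S
      have hSm : MeasurableSet ((S.1 : LocalConfig E) : Set E) :=
        (RootedHardCoreConfig.isClosed_coe hδ S).measurableSet
      rw [iUnion_inter, iUnion_inter]
      refine measure_iUnion (fun i j hij => ?_)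
        fun i => ((hfm i).inter measurableSet_closedBall).inter hSm
      exact ((hdisj hij).mono inter_subset_left inter_subset_left).mono
        inter_subset_left inter_subset_left
    simp_rw [hident, ENNReal.tsum_eq_iSup_sum]
    exact Measurable.iSup fun F => Finset.measurable_fun_sum F fun i _ => ih i m

/-- **The counting-measure map is Borel measurable into the Giry σ-algebra**: for `δ > 0` and
proper `E`, `S ↦ count|S` is measurable from the compact metric space of rooted `δ`-hard-core
configurations to `Measure E`. Consequently the law of a random rooted hard-core configuration
pushes forward to a law `P : Measure (Measure E)` of configurations-as-measures, the format of
`IsPointStationaryLaw` / `IsRootedHardCore`. (Measurability half of the topological conjugacy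
`δ : 𝒟_V → ℳ` of Baake–Lenz.) [cite: BaakeLenz2004, §4 Thm 4] -/
theorem measurable_toMeasure (hδ : 0 < δ) :
    Measurable fun S : RootedHardCoreConfig E δ => (S.1 : LocalConfig E).toMeasure := by
  refine Measure.measurable_of_measurable_coe _ fun s hs => ?_
  have hsup : ∀ S : RootedHardCoreConfig E δ, (S.1 : LocalConfig E).toMeasure s =
      ⨆ m : ℕ, (Measure.count : Measure E)
        (s ∩ closedBall (0 : E) m ∩ ((S.1 : LocalConfig E) : Set E)) := by
    intro S
    rw [toMeasure_def, Measure.restrict_apply hs]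
    have hunion : s ∩ ((S.1 : LocalConfig E) : Set E) =
        ⋃ m : ℕ, s ∩ closedBall (0 : E) m ∩ ((S.1 : LocalConfig E) : Set E) := by
      ext x
      simp only [mem_iUnion, mem_inter_iff, mem_closedBall_zero_iff]
      constructor
      · rintro ⟨hx, hxS⟩
        obtain ⟨m, hm⟩ := exists_nat_ge ‖x‖
        exact ⟨m, ⟨hx, hm⟩, hxS⟩
      · rintro ⟨m, ⟨hx, -⟩, hxS⟩
        exact ⟨hx, hxS⟩
    rw [hunion]
    refine Monotone.measure_iUnion fun m n hmn x hx => ⟨⟨hx.1.1, ?_⟩, hx.2⟩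
    exact mem_closedBall_zero_iff.2
      ((mem_closedBall_zero_iff.1 hx.1.2).trans (by exact_mod_cast hmn))
  simp_rw [hsup]
  exact Measurable.iSup fun m => measurable_count_inter_closedBall hδ hs m

end Measurable

end LocalConfig

end Literature.Probability.Process
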